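import Summits.BirchSwinnertonDyer.BirchSwinnertonDyer.Theorems.ManinLocalTwoThreeManinPrimeToAdditiveFiveLeOfPrintAndItems
import Summits.BirchSwinnertonDyer.BirchSwinnertonDyer.Theorems.ManinLocalTwoThreeManinPrimeToAdditiveFiveLeReducibleResidueOfFacts
import Summits.BirchSwinnertonDyer.Rank1Residual.Additive.PotentiallyOrdinaryTypeG
import Summits.BirchSwinnertonDyer.Rank1Residual.Additive.GordKodairaType
import Summits.BirchSwinnertonDyer.Rank1Residual.Additive.SubGordHigherOrdinary
import Summits.BirchSwinnertonDyer.Rank1Residual.ManinAdditive.TwistOrbitDegreeIdentity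
import Literature.NumberTheory.EllipticCurves.RationalIsogenyPrimeDegreeJInvariants
import HarnessLib

/-!
# Route `ManinLocalTwoThree`, residual crux C5 `ManinPrimeToAdditiveFiveLe`
# (stmt-BirchSwinnertonDyer-22969), line `upper_anchor`: the `W[p]`-REDUCIBLE core at `p > 7`
# **SHRINKS TO `p = 13`** (Mazur 1978, Thm. 1 + the rational points of `X₀(p)`)

Lead seat `bsd-line-ml23-c5-p1` (gen 2). The width seat's `reducibleTwistMinimal_of_edixhoven_cns_of_cores`
(p608852) closed the registered stub `stub_reducibleTwistMinimal` of the line skeleton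
`Cruxes/ManinPrimeToAdditiveFiveLe/Lines/upper_anchor.lean` MODULO Edixhoven 1991 Thm. 3 (both cite-only
halves), Česnavičius–Neururer–Saha Thm. 1.2, and two OPEN cores: RED(57) (`p ∈ {5, 7}`) and RED(11) —
`p > 7`, `W[p]` reducible, globally twist-minimal, `ord_p Δ_min(W) ≤ 4` (Kodaira II/III/IV), potentially
good ORDINARY at `p` in the (G)-shape, `p ∣ deg φ`, lattice-optimal conductor-level datum `D` ⟹ `p ∤ c(D)`.

THIS FILE: **RED(11) ⟸ RED(13)**, where RED(13) is RED(11) with `7 < p` replaced by `p = 13`, GRANTED one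
more printed fact — Mazur's theorem on rational isogenies of prime degree together with the classical
list of non-cuspidal rational points of `X₀(p)` for the seven primes `p ∈ {11, 17, 19, 37, 43, 67, 163}`
(the cite-only Literature fact `mazur_j_mem_of_not_hasIrreducibleModPGaloisRep_of_eleven_le` of
`Literature/NumberTheory/EllipticCurves/RationalIsogenyPrimeDegreeJInvariants.lean`). The point: a reducible `W[p]` at a prime `p ≥ 11`, `p ≠ 13`, pins
`j(W)` to eleven explicit values, and NONE of them is compatible with «additive, potentially good ORDINARY,
Kodaira II/III/IV at `p`»:
* `p ∈ {11, 17}`, `j ∈ {−11², −11·131³, −17²·101³/2, −17·373³/2¹⁷}`: `ord_p j > 0`, so any good fibre above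
  `p` has `j̃ = 0`, supersingular since `p ≡ 2 (mod 3)`
  (`Additive.not_hasUnitRootAt_of_valuation_j_lt_one_of_not_three_dvd`);
* `p = 11`, `j = −2¹⁵` and the CM values at `p ∈ {19, 43, 67, 163}`: `ord_p (j − 1728) > 0`
  (`j − 1728 = −p·t²`), so `j̃ = 1728`, supersingular since `p ≡ 3 (mod 4)`
  (`Additive.not_hasUnitRootAt_of_valuation_j_sub_lt_one_of_not_four_dvd`);
* `p = 37`, `j ∈ {−7·11³, −7·137³·2083³}`: `ord₃₇ j = ord₃₇ (j − 1728) = 0`, hence `6 ∣ ord₃₇ Δ_min`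
  (`Additive.j_eq_zero_or_padicValRat_j_pos_of_not_three_dvd`, `…_j_sub_pos_of_not_two_dvd`), i.e.
  semistability defect `∣ 2`, i.e. `ord₃₇ Δ_min > 4` (`Addv.four_lt_padicValInt_of_semistabilityIndex_dvd_two`)
  — not Kodaira II/III/IV.
So, by name: `coreRED11_of_mazurJ_of_coreRED13`, and the line ledger
`maninPrimeToAdditiveFiveLe_of_print_mazurJ_of_kp57_of_cores` (C5 BY NAME ⟸ seven printed facts ∧ KP57 ∧
RED(57) ∧ RED(13)); the stub-2 form (stub 2 ⟸ EdK ∧ EdG ∧ ČNS ∧ MazurJ ∧ RED(57) ∧ RED(13)) is the sequel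
file `…ReducibleResidueThirteenStub.lean`. In Cremona's range RED(13) is met by exactly the
`X₀(13)`-family classes `366054cc`, `366054bk` (type III at `13`, `13 ∣ deg φ`; lead's evidence #6/#11 on
the item), so the typed residual is faithful to the data.

HONEST STATUS. Conditional-result (`--supports … --as helper`); nothing is closed: RED(57), RED(13) and
KP57 are OPEN mathematics and every printed input is a cite-only `def … : Prop`. Nothing here proves BSD,
Manin's conjecture or C5.

References: [Mazur1978] Thm. 1 and the table of the Introduction; [LozanoRobledo2013MathAnn] Table 4;
[Chiloyan2024] Lemmas 8.6, 8.7; [SilvermanATAEC1994] App. A §3; [EdixhovenManin1991] Thm. 3;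
[CesnaviciusNeururerSaha2023] Thm. 1.2; [SilvermanAEC2009] VII.5.1, V.4.1.
-/

set_option autoImplicit false
-- the Theorems namespace of this sub repeats the summit name by design (D-0017 nested layout)
set_option linter.dupNamespace false

noncomputable section

open scoped Classical NumberField

namespace Summit.BirchSwinnertonDyer.BirchSwinnertonDyer.Theorems

open WeierstrassCurve IsDedekindDomain NumberField
  Literature.NumberTheory.EllipticCurves Literature.NumberTheory.EllipticCurves.ModularForms
  Literature.NumberTheory.EllipticCurves.Rank1Residual
  Summit.BirchSwinnertonDyer.Rank1Residual.ManinAdditive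
  Summit.BirchSwinnertonDyer.Rank1Residual.Additive
  Summit.BirchSwinnertonDyer.BirchSwinnertonDyer.Theses.EdixhovenFibreFiveSeven

/-! The printed input — Mazur 1978 Thm. 1 with the eleven `j`-invariants of the non-cuspidal rational
points of `X₀(p)`, `p ∈ {11, 17, 19, 37, 43, 67, 163}` — is the Literature fact
`Literature.NumberTheory.EllipticCurves.mazur_j_mem_of_not_hasIrreducibleModPGaloisRep_of_eleven_le`
(cite-only; relocated there by the gate from this file's first submission). -/

/-! ### Local lemmas: explicit `j` versus «additive, potentially good ordinary, unstarred» -/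

section Local

variable (W : WeierstrassCurve ℚ) [W.IsElliptic] [W.IsGloballyMinimal] (p : ℕ) [hp : Fact p.Prime]

/-- **`ord_p j > 0` (or `j = 0`) at an additive `p ≥ 5` with `p ≢ 1 (mod 3)` is potentially
SUPERSINGULAR**: `W` is not (G)-ordinary at `p`. Over any number field and any place above `p` of good
reduction the reduced curve has `j̃ = 0`, supersingular for `p ≡ 2 (mod 3)` (Silverman *AEC* V.4.1,
Ex. V.4.4; tree `not_hasUnitRootAt_of_valuation_j_lt_one_of_not_three_dvd`). [cite: SilvermanAEC2009, V.4.1(a) and Exercise V.4.4] -/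
theorem not_typeGOrd_of_padicValRat_j_pos_of_not_three_dvd (hp5 : 5 ≤ p) (hadd : Addv W p)
    (h3 : ¬ 3 ∣ p - 1) (hj : W.j = 0 ∨ 0 < padicValRat p W.j) : ¬ TypeGOrd W p := by
  intro hT
  obtain ⟨F, _, _, w, hw, hgood, hunit⟩ := (typeGOrd_iff_exists_good_unitRoot W p hp5 hadd).mp hT
  haveI : (W.baseChange F).IsElliptic := by rw [baseChange]; infer_instance
  have hjF : (W.baseChange F).j = algebraMap ℚ F W.j := W.map_j (algebraMap ℚ F)
  have hlt : w.valuation F (W.baseChange F).j < 1 := by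
    rw [hjF]; exact valuation_algebraMap_lt_one_of_padicValRat_pos p w hw hj
  exact not_hasUnitRootAt_of_valuation_j_lt_one_of_not_three_dvd (W.baseChange F) w hp.out hp5 h3 hw
    hgood hlt hunit

/-- **`ord_p (j − 1728) > 0` (or `j = 1728`) at an additive `p ≥ 5` with `p ≢ 1 (mod 4)` is potentially
SUPERSINGULAR**: `W` is not (G)-ordinary at `p` (`j̃ = 1728` is supersingular for `p ≡ 3 (mod 4)`;
Silverman *AEC* V.4.1, Ex. V.4.5; tree `not_hasUnitRootAt_of_valuation_j_sub_lt_one_of_not_four_dvd`).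
[cite: SilvermanAEC2009, V.4.1(a) and Exercise V.4.5] -/
theorem not_typeGOrd_of_padicValRat_j_sub_pos_of_not_four_dvd (hp5 : 5 ≤ p) (hadd : Addv W p)
    (h4 : ¬ 4 ∣ p - 1) (hj : W.j - 1728 = 0 ∨ 0 < padicValRat p (W.j - 1728)) : ¬ TypeGOrd W p := by
  intro hT
  obtain ⟨F, _, _, w, hw, hgood, hunit⟩ := (typeGOrd_iff_exists_good_unitRoot W p hp5 hadd).mp hT
  haveI : (W.baseChange F).IsElliptic := by rw [baseChange]; infer_instance
  have hjF : (W.baseChange F).j = algebraMap ℚ F W.j := W.map_j (algebraMap ℚ F)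
  have h1728 : (W.baseChange F).j - 1728 = algebraMap ℚ F (W.j - 1728) := by
    rw [map_sub, hjF, map_ofNat]
  have hlt : w.valuation F ((W.baseChange F).j - 1728) < 1 := by
    rw [h1728]; exact valuation_algebraMap_lt_one_of_padicValRat_pos p w hw hj
  exact not_hasUnitRootAt_of_valuation_j_sub_lt_one_of_not_four_dvd (W.baseChange F) w hp.out hp5 h4 hw
    hgood hlt hunit

/-- **`ord_p j = ord_p (j − 1728) = 0` at an additive `p ≥ 5` forces a STARRED fibre**
(`ord_p Δ_min > 4`): from `c₄³ = j·Δ`, `c₆² = (j − 1728)·Δ` one gets `3 ∣ ord_p Δ_min` and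
`2 ∣ ord_p Δ_min` (tree `j_eq_zero_or_padicValRat_j_pos_of_not_three_dvd`,
`j_eq_or_padicValRat_j_sub_pos_of_not_two_dvd`), so the semistability defect `12/gcd(12, ord_p Δ_min)`
divides `2` and the fibre is `I₀*`-like: `ord_p Δ_min ≥ 6` (`Addv.four_lt_padicValInt_of_semistabilityIndex_dvd_two`).
[cite: SilvermanATAEC1994, IV Table 4.1] -/
theorem four_lt_padicValInt_of_padicValRat_j_eq_zero_of_padicValRat_j_sub_eq_zero (hp5 : 5 ≤ p)
    (hadd : Addv W p) (hj0 : W.j ≠ 0) (hj : padicValRat p W.j = 0) (hj1728 : W.j ≠ 1728)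
    (hj' : padicValRat p (W.j - 1728) = 0) : 4 < padicValInt p W.minimalDiscriminantInt := by
  have h3 : 3 ∣ padicValInt p W.minimalDiscriminantInt := by
    by_contra h3
    rcases j_eq_zero_or_padicValRat_j_pos_of_not_three_dvd W p (le_of_eq hj.symm) h3 with h | h
    · exact hj0 h
    · rw [hj] at h; exact lt_irrefl _ h
  have h2 : 2 ∣ padicValInt p W.minimalDiscriminantInt := by
    by_contra h2
    rcases j_eq_or_padicValRat_j_sub_pos_of_not_two_dvd W p hp5 (le_of_eq hj.symm) h2 with h | h
    · exact hj1728 h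
    · rw [hj'] at h; exact lt_irrefl _ h
  have h6 : 6 ∣ padicValInt p W.minimalDiscriminantInt := by
    have h := Nat.Coprime.mul_dvd_of_dvd_of_dvd (by norm_num : Nat.Coprime 2 3) h2 h3
    simpa using h
  exact Addv.four_lt_padicValInt_of_semistabilityIndex_dvd_two W p hp5 hadd
    ((semistabilityIndex_dvd_two_iff W p).mpr h6)

end Local

/-! ### Valuations of the explicit `j`-invariants -/

/-- `ord_p a > 0` for a non-zero integer `a` divisible by `p` (as a rational number). [folklore] -/
theorem padicValRat_intCast_pos_of_dvd {p : ℕ} [hp : Fact p.Prime] {a : ℤ} (ha0 : a ≠ 0)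
    (ha : (p : ℤ) ∣ a) : 0 < padicValRat p (a : ℚ) := by
  rw [padicValRat.of_int]
  have h1 : a = 0 ∨ 1 ≤ padicValInt p a := (padicValInt_dvd_iff 1 a).mp (by rwa [pow_one])
  have h1' : 1 ≤ padicValInt p a := h1.resolve_left ha0
  exact_mod_cast h1'

/-- `ord_p (a/b) > 0` for integers `a ≠ 0` with `p ∣ a` and `b ∈ ℕ` with `p ∤ b`. [folklore] -/
theorem padicValRat_intCast_div_natCast_pos_of_dvd {p : ℕ} [hp : Fact p.Prime] {a : ℤ} {b : ℕ}
    (ha0 : a ≠ 0) (ha : (p : ℤ) ∣ a) (hb0 : b ≠ 0) (hb : ¬ p ∣ b) :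
    0 < padicValRat p ((a : ℚ) / (b : ℚ)) := by
  rw [padicValRat.div (by exact_mod_cast ha0) (by exact_mod_cast hb0), padicValRat.of_nat,
    padicValNat.eq_zero_of_not_dvd hb, Nat.cast_zero, sub_zero]
  exact padicValRat_intCast_pos_of_dvd ha0 ha

/-- `ord_p a = 0` for an integer `a` not divisible by `p` (as a rational number). [folklore] -/
theorem padicValRat_intCast_eq_zero_of_not_dvd {p : ℕ} {a : ℤ} (ha : ¬ (p : ℤ) ∣ a) :
    padicValRat p (a : ℚ) = 0 := by
  rw [padicValRat.of_int, padicValInt.eq_zero_of_not_dvd ha, Nat.cast_zero]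

/-! ### RED(11) ⟸ RED(13), granted Mazur's list -/

/-- **The `W[p]`-reducible core of C5 at `p > 7` shrinks to `p = 13`**, GRANTED Mazur 1978 Thm. 1 with
the rational points of `X₀(p)` (`hJ`, cite-only): core RED(11) of `reducibleTwistMinimal_of_edixhoven_cns_of_cores`
(its hypothesis `h11`, VERBATIM as the conclusion here) follows from core RED(13) (`h13`: the same
binders with `p = 13` in place of `7 < p`). Proof: for `p ≠ 13` the eleven `j`-values of `hJ` contradict
«additive ∧ (G)-ordinary ∧ `ord_p Δ_min ≤ 4`» by the three local lemmas above. Conditional-result.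
[cite: Mazur1978, Thm. 1] [cite: LozanoRobledo2013MathAnn, Table 4] [cite: Chiloyan2024, Lemmas 8.6, 8.7]
[cite: SilvermanAEC2009, V.4.1(a)] [cite: SilvermanATAEC1994, IV Table 4.1] -/
theorem coreRED11_of_mazurJ_of_coreRED13
    (hJ : mazur_j_mem_of_not_hasIrreducibleModPGaloisRep_of_eleven_le)
    (h13 : mazur_not_dvd_maninConstant_of_odd → abbesUllmo_not_dvd_maninConstant_of_not_dvd_level →
      cesnavicius_not_two_dvd_maninConstant_of_two_dvd_level → exists_isNewformOf →
      ∀ (W : WeierstrassCurve ℚ) [W.IsElliptic] [W.IsGloballyMinimal] [NeZero (W.conductorNorm ℤ)]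
        (D : ModularParametrizationData W (W.conductorNorm ℤ)),
        IsLatticeOptimal D → ∀ p : ℕ, p.Prime → p = 13 → p ^ 2 ∣ W.conductorNorm ℤ →
        ¬ (∃ (W' : WeierstrassCurve ℚ) (q : ℕ), W'.IsElliptic ∧ W'.IsGloballyMinimal ∧ q.Prime ∧
            q ≠ 2 ∧ q ^ 2 ∣ W.conductorNorm ℤ ∧
            IsIsogenous W (W'.quadraticTwist (((-1 : ℤ) ^ (q / 2) * q : ℤ) : ℚ)) ∧
            ¬ q ^ 2 ∣ W'.conductorNorm ℤ) →
        ¬ (∃ (W' : WeierstrassCurve ℚ) (d : ℤ), W'.IsElliptic ∧ W'.IsGloballyMinimal ∧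
            (d = -1 ∨ d = 2 ∨ d = -2) ∧ 2 ^ 2 ∣ W.conductorNorm ℤ ∧
            IsIsogenous W (W'.quadraticTwist (d : ℚ)) ∧ ¬ 2 ^ 2 ∣ W'.conductorNorm ℤ) →
        ¬ W.HasIrreducibleModPGaloisRep p →
        padicValInt p W.minimalDiscriminantInt ≤ 4 →
        (∃ (L : Type) (_ : Field L) (_ : NumberField L) (_ : IsCyclotomicExtension {p} ℚ L)
            (F : IntermediateField ℚ L),
            ∀ w : HeightOneSpectrum (𝓞 F), (p : 𝓞 F) ∈ w.asIdeal →
              (W.baseChange F).HasGoodReductionAt w ∧ (W.baseChange F).HasUnitRootAt w) →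
        p ∣ D.modularDegree →
        ¬ (p : ℤ) ∣ D.maninConstant) :
    mazur_not_dvd_maninConstant_of_odd → abbesUllmo_not_dvd_maninConstant_of_not_dvd_level →
    cesnavicius_not_two_dvd_maninConstant_of_two_dvd_level → exists_isNewformOf →
    ∀ (W : WeierstrassCurve ℚ) [W.IsElliptic] [W.IsGloballyMinimal] [NeZero (W.conductorNorm ℤ)]
      (D : ModularParametrizationData W (W.conductorNorm ℤ)),
      IsLatticeOptimal D → ∀ p : ℕ, p.Prime → 7 < p → p ^ 2 ∣ W.conductorNorm ℤ →
      ¬ (∃ (W' : WeierstrassCurve ℚ) (q : ℕ), W'.IsElliptic ∧ W'.IsGloballyMinimal ∧ q.Prime ∧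
          q ≠ 2 ∧ q ^ 2 ∣ W.conductorNorm ℤ ∧
          IsIsogenous W (W'.quadraticTwist (((-1 : ℤ) ^ (q / 2) * q : ℤ) : ℚ)) ∧
          ¬ q ^ 2 ∣ W'.conductorNorm ℤ) →
      ¬ (∃ (W' : WeierstrassCurve ℚ) (d : ℤ), W'.IsElliptic ∧ W'.IsGloballyMinimal ∧
          (d = -1 ∨ d = 2 ∨ d = -2) ∧ 2 ^ 2 ∣ W.conductorNorm ℤ ∧
          IsIsogenous W (W'.quadraticTwist (d : ℚ)) ∧ ¬ 2 ^ 2 ∣ W'.conductorNorm ℤ) →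
      ¬ W.HasIrreducibleModPGaloisRep p →
      padicValInt p W.minimalDiscriminantInt ≤ 4 →
      (∃ (L : Type) (_ : Field L) (_ : NumberField L) (_ : IsCyclotomicExtension {p} ℚ L)
          (F : IntermediateField ℚ L),
          ∀ w : HeightOneSpectrum (𝓞 F), (p : 𝓞 F) ∈ w.asIdeal →
            (W.baseChange F).HasGoodReductionAt w ∧ (W.baseChange F).HasUnitRootAt w) →
      p ∣ D.modularDegree →
      ¬ (p : ℤ) ∣ D.maninConstant := by
  intro hM hAU hC hnf W _ _ _ D hD p hp h7 hpN hodd hdy hred hlow hGo hdeg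
  haveI hpF : Fact p.Prime := ⟨hp⟩
  by_cases hp13 : p = 13
  · exact h13 hM hAU hC hnf W D hD p hp hp13 hpN hodd hdy hred hlow hGo hdeg
  exfalso
  have h11 : 11 ≤ p := by
    by_contra h11
    interval_cases p <;> exact absurd hp (by norm_num)
  have h5 : 5 ≤ p := by omega
  -- `W` is additive at `p` (`p² ∣ N`) and (G)-ordinary (the `∃`-clause is `TypeGOrd W p` verbatim)
  have hadd : Addv W p := not_good_and_not_mult_of_sq_dvd_conductorNorm W hpN
  have hT : TypeGOrd W p := hGo
  rcases hJ W p h11 hp13 hred with ⟨rfl, hj⟩ | ⟨rfl, hj⟩ | ⟨rfl, hj⟩ | ⟨rfl, hj⟩ | ⟨rfl, hj⟩ |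
    ⟨rfl, hj⟩ | ⟨rfl, hj⟩
  · -- `p = 11 ≡ 2 (mod 3) ≡ 3 (mod 4)`: `j ∈ {−2¹⁵ (j − 1728 = −11·56²), −11², −11·131³}`
    rcases hj with hj | hj | hj
    · refine not_typeGOrd_of_padicValRat_j_sub_pos_of_not_four_dvd W 11 h5 hadd (by norm_num)
        (Or.inr ?_) hT
      have h : W.j - 1728 = ((-34496 : ℤ) : ℚ) := by rw [hj]; norm_num
      rw [h]; exact padicValRat_intCast_pos_of_dvd (by norm_num) (by norm_num)
    · refine not_typeGOrd_of_padicValRat_j_pos_of_not_three_dvd W 11 h5 hadd (by norm_num)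
        (Or.inr ?_) hT
      have h : W.j = ((-121 : ℤ) : ℚ) := by rw [hj]; norm_num
      rw [h]; exact padicValRat_intCast_pos_of_dvd (by norm_num) (by norm_num)
    · refine not_typeGOrd_of_padicValRat_j_pos_of_not_three_dvd W 11 h5 hadd (by norm_num)
        (Or.inr ?_) hT
      have h : W.j = ((-24729001 : ℤ) : ℚ) := by rw [hj]; norm_num
      rw [h]; exact padicValRat_intCast_pos_of_dvd (by norm_num) (by norm_num)
  · -- `p = 17 ≡ 2 (mod 3)`: `j ∈ {−17²·101³/2, −17·373³/2¹⁷}`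
    rcases hj with hj | hj
    · refine not_typeGOrd_of_padicValRat_j_pos_of_not_three_dvd W 17 h5 hadd (by norm_num)
        (Or.inr ?_) hT
      have h : W.j = ((-297756989 : ℤ) : ℚ) / ((2 : ℕ) : ℚ) := by rw [hj]; norm_num
      rw [h]
      exact padicValRat_intCast_div_natCast_pos_of_dvd (by norm_num) (by norm_num) (by norm_num)
        (by norm_num)
    · refine not_typeGOrd_of_padicValRat_j_pos_of_not_three_dvd W 17 h5 hadd (by norm_num)
        (Or.inr ?_) hT
      have h : W.j = ((-882216989 : ℤ) : ℚ) / ((131072 : ℕ) : ℚ) := by rw [hj]; norm_num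
      rw [h]
      exact padicValRat_intCast_div_natCast_pos_of_dvd (by norm_num) (by norm_num) (by norm_num)
        (by norm_num)
  · -- `p = 19 ≡ 3 (mod 4)`: `j = −2¹⁵·3³`, `j − 1728 = −19·216²`
    refine not_typeGOrd_of_padicValRat_j_sub_pos_of_not_four_dvd W 19 h5 hadd (by norm_num)
      (Or.inr ?_) hT
    have h : W.j - 1728 = ((-886464 : ℤ) : ℚ) := by rw [hj]; norm_num
    rw [h]; exact padicValRat_intCast_pos_of_dvd (by norm_num) (by norm_num)
  · -- `p = 37`: `j ∈ {−7·11³, −7·137³·2083³}`, both `37`-adic units with `j − 1728` a `37`-adic unit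
    have hv : padicValRat 37 W.j = 0 ∧ padicValRat 37 (W.j - 1728) = 0 ∧ W.j ≠ 0 ∧ W.j ≠ 1728 := by
      rcases hj with hj | hj
      · have h : W.j = ((-9317 : ℤ) : ℚ) := by rw [hj]; norm_num
        have h' : W.j - 1728 = ((-11045 : ℤ) : ℚ) := by rw [hj]; norm_num
        refine ⟨?_, ?_, ?_, ?_⟩
        · rw [h]; exact padicValRat_intCast_eq_zero_of_not_dvd (by norm_num)
        · rw [h']; exact padicValRat_intCast_eq_zero_of_not_dvd (by norm_num)
        · rw [hj]; norm_num
        · rw [hj]; norm_num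
      · have h : W.j = ((-162677523113838677 : ℤ) : ℚ) := by rw [hj]; norm_num
        have h' : W.j - 1728 = ((-162677523113840405 : ℤ) : ℚ) := by rw [hj]; norm_num
        refine ⟨?_, ?_, ?_, ?_⟩
        · rw [h]; exact padicValRat_intCast_eq_zero_of_not_dvd (by norm_num)
        · rw [h']; exact padicValRat_intCast_eq_zero_of_not_dvd (by norm_num)
        · rw [hj]; norm_num
        · rw [hj]; norm_num
    obtain ⟨hv0, hv1, hj0, hj1728⟩ := hv
    have hlt := four_lt_padicValInt_of_padicValRat_j_eq_zero_of_padicValRat_j_sub_eq_zero W 37 h5 hadd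
      hj0 hv0 hj1728 hv1
    omega
  · -- `p = 43 ≡ 3 (mod 4)`: `j = −2¹⁸·3³·5³`, `j − 1728 = −43·4536²`
    refine not_typeGOrd_of_padicValRat_j_sub_pos_of_not_four_dvd W 43 h5 hadd (by norm_num)
      (Or.inr ?_) hT
    have h : W.j - 1728 = ((-884737728 : ℤ) : ℚ) := by rw [hj]; norm_num
    rw [h]; exact padicValRat_intCast_pos_of_dvd (by norm_num) (by norm_num)
  · -- `p = 67 ≡ 3 (mod 4)`: `j = −2¹⁵·3³·5³·11³`, `j − 1728 = −67·46872²`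
    refine not_typeGOrd_of_padicValRat_j_sub_pos_of_not_four_dvd W 67 h5 hadd (by norm_num)
      (Or.inr ?_) hT
    have h : W.j - 1728 = ((-147197953728 : ℤ) : ℚ) := by rw [hj]; norm_num
    rw [h]; exact padicValRat_intCast_pos_of_dvd (by norm_num) (by norm_num)
  · -- `p = 163 ≡ 3 (mod 4)`: `j = −2¹⁸·3³·5³·23³·29³`, `j − 1728 = −163·40133016²`
    refine not_typeGOrd_of_padicValRat_j_sub_pos_of_not_four_dvd W 163 h5 hadd (by norm_num)
      (Or.inr ?_) hT
    have h : W.j - 1728 = ((-262537412640769728 : ℤ) : ℚ) := by rw [hj]; norm_num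
    rw [h]; exact padicValRat_intCast_pos_of_dvd (by norm_num) (by norm_num)

/-! ### Recomposition: C5 by name -/

/-- **C5 `ManinPrimeToAdditiveFiveLe` BY NAME ⟸ seven printed facts + KP57 + RED(57) + RED(13)** — the
line `upper_anchor`'s ledger after this file (conditional-result; C5 is NOT proved): Kato F′ (`hK`), Kato
F″ (`hK57`), ČNS Thm. 1.2 (`hCNS`), Cremona ≤ 5·10⁵ (`h500k`), the registered crux KP57 BY NAME (`hKP57`,
stmt-BirchSwinnertonDyer-23810), Edixhoven Thm. 3 Kodaira half (`hEdK`) and ordinarity half (`hEdG`),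
Mazur's list (`hJ`); open cores RED(57) (`h57`: `p ∈ {5, 7}`, `W[p]` reducible, globally twist-minimal)
and RED(13) (`h13`: `p = 13`, `W[13]` reducible, globally twist-minimal, Kodaira II/III/IV at `13`,
potentially good ordinary, `13 ∣ deg φ`). The width seat's ledger
`maninPrimeToAdditiveFiveLe_of_print_of_kp57_of_reducibleCores` (p609533/δ″) with its RED(11) cut to RED(13).
[cite: Mazur1978, Thm. 1] [cite: EdixhovenManin1991, Thm. 3] [cite: CesnaviciusNeururerSaha2023, Thm. 1.2]
[cite: Kato2004Asterisque, (8.1.3) (p. 180), Thm. 9.7 (p. 189)] [cite: KostersPannekoek2017, Thm. 1 and Cor. 2] -/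
theorem maninPrimeToAdditiveFiveLe_of_print_mazurJ_of_kp57_of_cores
    (hK : kato_neron_isIntegral_twistedSymbolSum_of_additive)
    (hK57 : kato_neron_isIntegral_twistedSymbolSum_of_additive_five_le)
    (hCNS : cesnaviciusNeururerSaha_padicVal_maninConstant_le_modularDegree)
    (h500k : cremona_abs_maninConstant_eq_one_of_level_le_500000)
    (hKP57 : KPResidueManinUnitFiveSeven)
    (hEdK : edixhoven_not_dvd_maninConstant_of_kodairaSymbol_ne)
    (hEdG : edixhoven_not_dvd_maninConstant_of_not_potentiallyGoodOrdinary)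
    (hJ : mazur_j_mem_of_not_hasIrreducibleModPGaloisRep_of_eleven_le)
    (h57 : mazur_not_dvd_maninConstant_of_odd → abbesUllmo_not_dvd_maninConstant_of_not_dvd_level →
      cesnavicius_not_two_dvd_maninConstant_of_two_dvd_level → exists_isNewformOf →
      ∀ (W : WeierstrassCurve ℚ) [W.IsElliptic] [W.IsGloballyMinimal] [NeZero (W.conductorNorm ℤ)]
        (D : ModularParametrizationData W (W.conductorNorm ℤ)),
        IsLatticeOptimal D → ∀ p : ℕ, p.Prime → (p = 5 ∨ p = 7) → p ^ 2 ∣ W.conductorNorm ℤ →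
        ¬ (∃ (W' : WeierstrassCurve ℚ) (q : ℕ), W'.IsElliptic ∧ W'.IsGloballyMinimal ∧ q.Prime ∧
            q ≠ 2 ∧ q ^ 2 ∣ W.conductorNorm ℤ ∧
            IsIsogenous W (W'.quadraticTwist (((-1 : ℤ) ^ (q / 2) * q : ℤ) : ℚ)) ∧
            ¬ q ^ 2 ∣ W'.conductorNorm ℤ) →
        ¬ (∃ (W' : WeierstrassCurve ℚ) (d : ℤ), W'.IsElliptic ∧ W'.IsGloballyMinimal ∧
            (d = -1 ∨ d = 2 ∨ d = -2) ∧ 2 ^ 2 ∣ W.conductorNorm ℤ ∧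
            IsIsogenous W (W'.quadraticTwist (d : ℚ)) ∧ ¬ 2 ^ 2 ∣ W'.conductorNorm ℤ) →
        ¬ W.HasIrreducibleModPGaloisRep p →
        ¬ (p : ℤ) ∣ D.maninConstant)
    (h13 : mazur_not_dvd_maninConstant_of_odd → abbesUllmo_not_dvd_maninConstant_of_not_dvd_level →
      cesnavicius_not_two_dvd_maninConstant_of_two_dvd_level → exists_isNewformOf →
      ∀ (W : WeierstrassCurve ℚ) [W.IsElliptic] [W.IsGloballyMinimal] [NeZero (W.conductorNorm ℤ)]
        (D : ModularParametrizationData W (W.conductorNorm ℤ)),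
        IsLatticeOptimal D → ∀ p : ℕ, p.Prime → p = 13 → p ^ 2 ∣ W.conductorNorm ℤ →
        ¬ (∃ (W' : WeierstrassCurve ℚ) (q : ℕ), W'.IsElliptic ∧ W'.IsGloballyMinimal ∧ q.Prime ∧
            q ≠ 2 ∧ q ^ 2 ∣ W.conductorNorm ℤ ∧
            IsIsogenous W (W'.quadraticTwist (((-1 : ℤ) ^ (q / 2) * q : ℤ) : ℚ)) ∧
            ¬ q ^ 2 ∣ W'.conductorNorm ℤ) →
        ¬ (∃ (W' : WeierstrassCurve ℚ) (d : ℤ), W'.IsElliptic ∧ W'.IsGloballyMinimal ∧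
            (d = -1 ∨ d = 2 ∨ d = -2) ∧ 2 ^ 2 ∣ W.conductorNorm ℤ ∧
            IsIsogenous W (W'.quadraticTwist (d : ℚ)) ∧ ¬ 2 ^ 2 ∣ W'.conductorNorm ℤ) →
        ¬ W.HasIrreducibleModPGaloisRep p →
        padicValInt p W.minimalDiscriminantInt ≤ 4 →
        (∃ (L : Type) (_ : Field L) (_ : NumberField L) (_ : IsCyclotomicExtension {p} ℚ L)
            (F : IntermediateField ℚ L),
            ∀ w : HeightOneSpectrum (𝓞 F), (p : 𝓞 F) ∈ w.asIdeal →
              (W.baseChange F).HasGoodReductionAt w ∧ (W.baseChange F).HasUnitRootAt w) →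
        p ∣ D.modularDegree →
        ¬ (p : ℤ) ∣ D.maninConstant) :
    Summit.BirchSwinnertonDyer.BirchSwinnertonDyer.Theses.ManinLocalTwoThree.ManinPrimeToAdditiveFiveLe :=
  maninPrimeToAdditiveFiveLe_of_print_of_kp57_of_reducibleCores hK hK57 hCNS h500k hKP57 hEdK hEdG h57
    (coreRED11_of_mazurJ_of_coreRED13 hJ h13)

end Summit.BirchSwinnertonDyer.BirchSwinnertonDyer.Theorems

end
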